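import Summits.CriticalPhenomena.CardyFormulaZ2.Theorems.CardySelfDualSegmentSegmentClosedOfRectilinearMarginality

/-!
# The route `CardySelfDualSegment` with marginality on RECTILINEAR conformal rectangles only
(crux `UniformMarginality`, stmt-CriticalPhenomena-5472, line `Sketch`; lead prover-line-stmt-CriticalPhenomena-5472-c2-0)

Template, proved now, for the planner's minimal restatement of the route: replace the crux
`UniformMarginality` (UM, all conformal rectangles) by its restriction UM_rect to rectilinear conformal
rectangles (boundary covered by finitely many axis-parallel segments; = stub (B₁) of line `Sketch`,
`uniformMarginalityRect_iff_integratedBoundRectilinear`) and the UM antecedent of `SegmentOpen` likewise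
(`SegmentOpen_rect := UM_rect → IsOpen G`). Then

* `target_of_rectilinearMarginality` : SegmentOpen_rect → UM_rect → UBC → SmirnovBasePoint → Target — the continuity
  sweep on `[0,1]` with CLOSEDNESS no longer a hypothesis: it is the landed
  `segmentClosed_of_rectilinearMarginality` (p137582: UBC → UM_rect → `G` closed);
* `closes_of_rectilinearMarginality` : SegmentOpen_rect → UM_rect → UBC → SmirnovBasePoint → QuarterTurnPinning →
  CrudeToCanonical → CardyFormulaZ2 — the restated deciding theorem (one crux FEWER than `closes`: no
  `SegmentClosed`), by the route's own endpoint steps;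
* `uniformMarginality_of_restatedCruxes` : SegmentOpen_rect → UM_rect → UBC → SmirnovBasePoint → UniformMarginality —
  the crux AS FILED (all conformal rectangles) is a corollary of the restated cruxes, through the Target and
  the landed (T) `uniformMarginality_of_rectilinear_of_target` (p137344).

`G`, `CardyMod`, `Target`, `SmirnovBasePoint`, `QuarterTurnPinning`, `CrudeToCanonical` are the route's, untouched
(over the tree's `cornerCrossingProb` / `cornerPercolation`, definitionally the route's `P` and law).
-/

noncomputable section

open Set Filter
open scoped Topology
open Literature.Probability.RandomPlanarGeometry Literature.Probability.Percolation
open Literature.Probability.LatticeModels Literature.Barriers.CriticalPhenomena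

namespace Summit.CriticalPhenomena.CardyFormulaZ2.Cruxes.UniformMarginality.HeatFlow

/-- **The continuity sweep with marginality on rectilinear conformal rectangles.** If `G` is open given
UM_rect (`SegmentOpen_rect`), UM_rect holds, the uniform box-crossing property holds (UBC) and the Smirnov base
point `0 ∈ G` holds, then `G = [0,1]`, i.e. the route's `Target`: `G` is closed by the landed
`segmentClosed_of_rectilinearMarginality`, clopen and non-empty in the preconnected `unitInterval`. -/
theorem target_of_rectilinearMarginality :
    ((∀ (t₀ : unitInterval) (R : ConformalRectangle),
        (∃ S : Finset (ℂ × ℂ), (∀ p ∈ S, p.1.re = p.2.re ∨ p.1.im = p.2.im) ∧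
          frontier R.carrier ⊆ ⋃ p ∈ S, segment ℝ p.1 p.2) →
        ∀ ε : ℝ, 0 < ε → ∃ η > 0, ∀ t : unitInterval, dist t t₀ < η → ∀ δ : ℝ, 0 < δ →
          |Literature.Probability.Percolation.cornerCrossingProb t R δ -
            Literature.Probability.Percolation.cornerCrossingProb t₀ R δ| < ε) →
      IsOpen {t : unitInterval | ∃ α : ℂ, 0 < α.im ∧
        ∀ (R R' : ConformalRectangle)
          (φ : Literature.Probability.RandomPlanarGeometry.ConformalEquiv UpperHalfPlane.upperHalfPlaneSet R.carrier)
          (x : Fin 4 → ℝ),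
          R.carrier = Literature.Barriers.CriticalPhenomena.moduliShear α '' R'.carrier →
          (∀ i, R.pt i = Literature.Barriers.CriticalPhenomena.moduliShear α (R'.pt i)) →
          R.IsUniformizing φ x →
          Filter.Tendsto (Literature.Probability.Percolation.cornerCrossingProb t R') (nhdsWithin 0 (Set.Ioi 0))
            (nhds (Literature.Probability.RandomPlanarGeometry.cardyFunction
              (Literature.Probability.RandomPlanarGeometry.crossRatio x)))}) →
    (∀ (t₀ : unitInterval) (R : ConformalRectangle),
      (∃ S : Finset (ℂ × ℂ), (∀ p ∈ S, p.1.re = p.2.re ∨ p.1.im = p.2.im) ∧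
        frontier R.carrier ⊆ ⋃ p ∈ S, segment ℝ p.1 p.2) →
      ∀ ε : ℝ, 0 < ε → ∃ η > 0, ∀ t : unitInterval, dist t t₀ < η → ∀ δ : ℝ, 0 < δ →
        |Literature.Probability.Percolation.cornerCrossingProb t R δ -
          Literature.Probability.Percolation.cornerCrossingProb t₀ R δ| < ε) →
    (∀ ρ : ℝ, 0 < ρ → ∃ c > 0, ∃ n₀ : ℕ, ∀ t : unitInterval,
      Literature.Probability.LatticeModels.BoxCrossingBounds
        (Literature.Probability.Percolation.cornerPercolation t)
        Literature.Probability.LatticeModels.squareLatticeEmbedding.z ρ c n₀) →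
    Summit.CriticalPhenomena.CardyFormulaZ2.Theses.CardySelfDualSegment.SmirnovBasePoint →
    Summit.CriticalPhenomena.CardyFormulaZ2.Theses.CardySelfDualSegment.Target := by
  intro hO hM hX hB
  -- `G` is open (hypothesis, fed by UM_rect) and closed (landed, from UBC and UM_rect)
  have hGo := hO hM
  have hGc := segmentClosed_of_rectilinearMarginality hX hM
  have hclopen : IsClopen _ := ⟨hGc, hGo⟩
  -- `unitInterval` is preconnected and `0 ∈ G` (Smirnov base point, `Im ζ > 0`), so `G = univ`
  haveI : PreconnectedSpace unitInterval := Subtype.preconnectedSpace isPreconnected_Icc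
  have hz : 0 < Literature.Probability.LatticeModels.triZeta.im := by
    rw [Literature.Probability.LatticeModels.triZeta_im]; positivity
  have huniv := hclopen.eq_univ ⟨0, Literature.Probability.LatticeModels.triZeta, hz, hB⟩
  -- `Target` is `G = univ` read pointwise
  unfold Summit.CriticalPhenomena.CardyFormulaZ2.Theses.CardySelfDualSegment.Target
  intro prm cfg P CardyMod t
  exact (Set.eq_univ_iff_forall.mp huniv) t

/-- **The restated deciding theorem.** With the crux `UniformMarginality` weakened to rectilinear conformal
rectangles (UM_rect) and `SegmentOpen` restated accordingly (`SegmentOpen_rect := UM_rect → IsOpen G`), the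
route still closes the sub-problem, and needs one crux fewer (`SegmentClosed` is the landed
`segmentClosed_of_rectilinearMarginality`): SegmentOpen_rect → UM_rect → UBC → SmirnovBasePoint →
QuarterTurnPinning → CrudeToCanonical → CardyFormulaZ2 (sweep, then the route's endpoint steps at `t = 1`). -/
theorem closes_of_rectilinearMarginality :
    ((∀ (t₀ : unitInterval) (R : ConformalRectangle),
        (∃ S : Finset (ℂ × ℂ), (∀ p ∈ S, p.1.re = p.2.re ∨ p.1.im = p.2.im) ∧
          frontier R.carrier ⊆ ⋃ p ∈ S, segment ℝ p.1 p.2) →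
        ∀ ε : ℝ, 0 < ε → ∃ η > 0, ∀ t : unitInterval, dist t t₀ < η → ∀ δ : ℝ, 0 < δ →
          |Literature.Probability.Percolation.cornerCrossingProb t R δ -
            Literature.Probability.Percolation.cornerCrossingProb t₀ R δ| < ε) →
      IsOpen {t : unitInterval | ∃ α : ℂ, 0 < α.im ∧
        ∀ (R R' : ConformalRectangle)
          (φ : Literature.Probability.RandomPlanarGeometry.ConformalEquiv UpperHalfPlane.upperHalfPlaneSet R.carrier)
          (x : Fin 4 → ℝ),
          R.carrier = Literature.Barriers.CriticalPhenomena.moduliShear α '' R'.carrier →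
          (∀ i, R.pt i = Literature.Barriers.CriticalPhenomena.moduliShear α (R'.pt i)) →
          R.IsUniformizing φ x →
          Filter.Tendsto (Literature.Probability.Percolation.cornerCrossingProb t R') (nhdsWithin 0 (Set.Ioi 0))
            (nhds (Literature.Probability.RandomPlanarGeometry.cardyFunction
              (Literature.Probability.RandomPlanarGeometry.crossRatio x)))}) →
    (∀ (t₀ : unitInterval) (R : ConformalRectangle),
      (∃ S : Finset (ℂ × ℂ), (∀ p ∈ S, p.1.re = p.2.re ∨ p.1.im = p.2.im) ∧
        frontier R.carrier ⊆ ⋃ p ∈ S, segment ℝ p.1 p.2) →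
      ∀ ε : ℝ, 0 < ε → ∃ η > 0, ∀ t : unitInterval, dist t t₀ < η → ∀ δ : ℝ, 0 < δ →
        |Literature.Probability.Percolation.cornerCrossingProb t R δ -
          Literature.Probability.Percolation.cornerCrossingProb t₀ R δ| < ε) →
    (∀ ρ : ℝ, 0 < ρ → ∃ c > 0, ∃ n₀ : ℕ, ∀ t : unitInterval,
      Literature.Probability.LatticeModels.BoxCrossingBounds
        (Literature.Probability.Percolation.cornerPercolation t)
        Literature.Probability.LatticeModels.squareLatticeEmbedding.z ρ c n₀) →
    Summit.CriticalPhenomena.CardyFormulaZ2.Theses.CardySelfDualSegment.SmirnovBasePoint →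
    Summit.CriticalPhenomena.CardyFormulaZ2.Theses.CardySelfDualSegment.QuarterTurnPinning →
    Summit.CriticalPhenomena.CardyFormulaZ2.Theses.CardySelfDualSegment.CrudeToCanonical →
    _root_.CardyFormulaZ2 := by
  intro hO hM hX hB hQ hD R
  -- Target (sweep) read at `t = 1`, then endpoint pinning and the global discretisation bridge
  have hT := target_of_rectilinearMarginality hO hM hX hB
  refine hD (hQ ?_) R
  exact hT 1

/-- **The crux as filed is a corollary of the restated cruxes.** `UniformMarginality` for EVERY conformal
rectangle follows from SegmentOpen_rect, UM_rect, UBC and SmirnovBasePoint: the sweep gives the Target, and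
(T) `uniformMarginality_of_rectilinear_of_target` (the wild-domain half of the crux is implied by the Target)
with UM_rect = (B₁) (`uniformMarginalityRect_iff_integratedBoundRectilinear`) concludes. -/
theorem uniformMarginality_of_restatedCruxes :
    ((∀ (t₀ : unitInterval) (R : ConformalRectangle),
        (∃ S : Finset (ℂ × ℂ), (∀ p ∈ S, p.1.re = p.2.re ∨ p.1.im = p.2.im) ∧
          frontier R.carrier ⊆ ⋃ p ∈ S, segment ℝ p.1 p.2) →
        ∀ ε : ℝ, 0 < ε → ∃ η > 0, ∀ t : unitInterval, dist t t₀ < η → ∀ δ : ℝ, 0 < δ →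
          |Literature.Probability.Percolation.cornerCrossingProb t R δ -
            Literature.Probability.Percolation.cornerCrossingProb t₀ R δ| < ε) →
      IsOpen {t : unitInterval | ∃ α : ℂ, 0 < α.im ∧
        ∀ (R R' : ConformalRectangle)
          (φ : Literature.Probability.RandomPlanarGeometry.ConformalEquiv UpperHalfPlane.upperHalfPlaneSet R.carrier)
          (x : Fin 4 → ℝ),
          R.carrier = Literature.Barriers.CriticalPhenomena.moduliShear α '' R'.carrier →
          (∀ i, R.pt i = Literature.Barriers.CriticalPhenomena.moduliShear α (R'.pt i)) →
          R.IsUniformizing φ x →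
          Filter.Tendsto (Literature.Probability.Percolation.cornerCrossingProb t R') (nhdsWithin 0 (Set.Ioi 0))
            (nhds (Literature.Probability.RandomPlanarGeometry.cardyFunction
              (Literature.Probability.RandomPlanarGeometry.crossRatio x)))}) →
    (∀ (t₀ : unitInterval) (R : ConformalRectangle),
      (∃ S : Finset (ℂ × ℂ), (∀ p ∈ S, p.1.re = p.2.re ∨ p.1.im = p.2.im) ∧
        frontier R.carrier ⊆ ⋃ p ∈ S, segment ℝ p.1 p.2) →
      ∀ ε : ℝ, 0 < ε → ∃ η > 0, ∀ t : unitInterval, dist t t₀ < η → ∀ δ : ℝ, 0 < δ →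
        |Literature.Probability.Percolation.cornerCrossingProb t R δ -
          Literature.Probability.Percolation.cornerCrossingProb t₀ R δ| < ε) →
    (∀ ρ : ℝ, 0 < ρ → ∃ c > 0, ∃ n₀ : ℕ, ∀ t : unitInterval,
      Literature.Probability.LatticeModels.BoxCrossingBounds
        (Literature.Probability.Percolation.cornerPercolation t)
        Literature.Probability.LatticeModels.squareLatticeEmbedding.z ρ c n₀) →
    Summit.CriticalPhenomena.CardyFormulaZ2.Theses.CardySelfDualSegment.SmirnovBasePoint →
    Summit.CriticalPhenomena.CardyFormulaZ2.Theses.CardySelfDualSegment.UniformMarginality :=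
  fun hO hM hX hB => uniformMarginality_of_rectilinear_of_target
    (uniformMarginalityRect_iff_integratedBoundRectilinear.1 hM) (target_of_rectilinearMarginality hO hM hX hB)

end Summit.CriticalPhenomena.CardyFormulaZ2.Cruxes.UniformMarginality.HeatFlow

end
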